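import Summits.QuantumFields.YangMills.Theorems.IR.SCFloorTorusCov

/-!
# Strong-coupling floor engine, part 9: the facing-plaquette covariance on the torus to order `b⁴` — assembly

Pooled prover `ym-ir-line-bsf-p1` (crux `IR`, stmt-QuantumFields-19354; director-ym R366 pooled queue), support file for
`FacingPlaquetteCovFloor`.  On the 4-torus of side `L ≥ 3`, for a continuous matrix representation `ρ` of a compact
group, the Wilson-state covariance of the two FACING plaquette observables `Re tr ρ(U_{P₀})`, `Re tr ρ(U_{P₁})`
(`P₀ = (0;1,2)`, `P₁ = (e₀;1,2)`) satisfies, for `|b| ≤ b₁`, `|Cov_b − φ^{*6}(1)·b⁴| ≤ K|b|⁵`, `φ = Re tr ρ − m₀`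
(`torus_cov_facing_estimate`).  `K, b₁` depend on the torus; the COEFFICIENT `φ^{*6}(1) > 0` (part 2) does not — this is
what the volume-uniform Schwarz bound (part 10) consumes.  Assembly of parts 5–8 with the doubling identity of
`BetaSlopeFloorRungStrongCoupling`.  Nothing here bears on the Yang–Mills mass gap.
-/

set_option autoImplicit false

noncomputable section

open MeasureTheory Filter Topology Function Finset
open Literature.MathematicalPhysics.QuantumFieldTheory
open Literature.MathematicalPhysics.QuantumLattice (haarConv)

namespace Summit.QuantumFields.YangMills.Cruxes.IR.SCFloor

open BetaSlopeFloor (dTerm measurable_dTerm exists_bound_plaquetteCost measurable_inl_copy measurable_inr_copy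
  covariance_wilsonMeasure_eq_doubled partition_pos)

variable {L : ℕ} [NeZero L] [Fact (1 < L)] {G : Type} [Group G] [TopologicalSpace G] [IsTopologicalGroup G]
  [CompactSpace G] [MeasurableSpace G] [BorelSpace G] [SecondCountableTopology G] [T2Space G]
  {N : ℕ} (ρ : G →* Matrix (Fin N) (Fin N) ℂ)

/-- **The facing-plaquette covariance on the torus to order `b⁴`.**  For `|b| ≤ b₁`:
`|Cov_{wilsonMeasure ρ b}(Re tr ρ(U_{P₀}), Re tr ρ(U_{P₁})) − φ^{*6}(1)·b⁴| ≤ K|b|⁵`, `φ = Re tr ρ − ∫ Re tr ρ`. -/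
theorem torus_cov_facing_estimate (hρ : Continuous ρ) (hL : 3 ≤ L) :
    ∃ K b₁ : ℝ, 0 < b₁ ∧ ∀ b : ℝ, |b| ≤ b₁ →
      |((∫ U, (ρ (plaquetteHolonomy U 0 1 2)).trace.re * (ρ (plaquetteHolonomy U ((0 : Site 4 L).shift 0) 1 2)).trace.re
            ∂(wilsonMeasure (d := 4) (L := L) ρ b)) -
          (∫ U, (ρ (plaquetteHolonomy U 0 1 2)).trace.re ∂(wilsonMeasure (d := 4) (L := L) ρ b)) *
            ∫ U, (ρ (plaquetteHolonomy U ((0 : Site 4 L).shift 0) 1 2)).trace.re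
              ∂(wilsonMeasure (d := 4) (L := L) ρ b)) -
        ((haarConv (fun g => (ρ g).trace.re - ∫ h, (ρ h).trace.re ∂haarProbability G))^[5]
          (fun g => (ρ g).trace.re - ∫ h, (ρ h).trace.re ∂haarProbability G)) 1 * b ^ 4| ≤ K * |b| ^ 5 := by
  classical
  -- the centred class function and its properties
  set m₀ : ℝ := ∫ h, (ρ h).trace.re ∂haarProbability G with hm₀
  set φ : G → ℝ := fun g => (ρ g).trace.re - m₀ with hφ
  set J : ℝ := ((haarConv φ)^[5] φ) 1 with hJ
  have hφc : Continuous φ := (continuous_trace_re ρ hρ).sub continuous_const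
  have hφz : ∀ g h, φ (h * g * h⁻¹) = φ g := fun g h => by
    simp only [hφ, Literature.RepresentationTheory.CompactGroups.CompactGroup.trace_conj_eq]
  have hφs : ∀ g, φ g⁻¹ = φ g := fun g => by
    simp only [hφ, Literature.RepresentationTheory.CompactGroups.CompactGroup.re_trace_map_inv ρ hρ]
  have hφ0 : ∫ g, φ g ∂haarProbability G = 0 := by
    simp only [hφ]
    rw [integral_sub ((continuous_trace_re ρ hρ).integrable_of_hasCompactSupport
      (HasCompactSupport.of_compactSpace _)) (integrable_const _)]
    simp [hm₀]
  have hcost : ∀ h : G, (N : ℝ) - (ρ h).trace.re = ((N : ℝ) - m₀) - φ h := fun h => by simp only [hφ]; ring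
  have hφm : Measurable φ := hφc.measurable
  obtain ⟨Cφ, hCφ⟩ := isCompact_univ.exists_bound_of_continuousOn hφc.continuousOn
  have hCφ' : ∀ g, |φ g| ≤ Cφ := fun g => Real.norm_eq_abs _ ▸ hCφ g (Set.mem_univ g)
  have hC0 : 0 ≤ Cφ := (abs_nonneg _).trans (hCφ' 1)
  -- constants
  obtain ⟨K₁, b₁, hb₁, hlat⟩ := lateral_term_estimate (L := L) ρ hL hφc hφz hφs hφ0 hcost
  obtain ⟨B, hB0, hB⟩ := exists_bound_plaquetteCost (L := L) ρ hρ
  obtain ⟨Smax, hSmax⟩ := exists_abs_wilsonAction_le (d := 4) (L := L) ρ hρ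
  have hSmax0 : 0 ≤ Smax := (abs_nonneg _).trans (hSmax fun _ => 1)
  set nP : ℝ := ((Finset.univ : Finset (Plaquette 4 L)).powerset.card : ℝ) with hnP
  set σ2 : ℝ := (2 * Cφ) * (2 * Cφ) with hσ2
  refine ⟨4 * (K₁ / 2 + nP * σ2 * (4 * B) ^ 5 / 2) + 24 * |J| * Smax,
    min b₁ (min (1 / (4 * B + 1)) (1 / (4 * Smax + 1))), by positivity, fun b hb => ?_⟩
  have hbb₁ : |b| ≤ b₁ := hb.trans (min_le_left _ _)
  have hbB : 4 * B * |b| ≤ 1 := by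
    have h := hb.trans ((min_le_right _ _).trans (min_le_left _ _))
    rw [le_div_iff₀ (by positivity)] at h; nlinarith [abs_nonneg b]
  have hbS : 4 * Smax * |b| ≤ 1 := by
    have h := hb.trans ((min_le_right _ _).trans (min_le_right _ _))
    rw [le_div_iff₀ (by positivity)] at h; nlinarith [abs_nonneg b]
  -- the Mayer parameter
  set γ : ℝ := 2 * B * |b| * Real.exp (2 * B * |b|) with hγ
  have hγ0 : 0 ≤ γ := by positivity
  have he2 : Real.exp (2 * B * |b|) ≤ 2 := by
    calc Real.exp (2 * B * |b|) ≤ Real.exp (1 / 2) := Real.exp_le_exp.2 (by nlinarith [abs_nonneg b])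
      _ ≤ 2 := by
        have h2 : Real.exp (1 / 2) * Real.exp (1 / 2) = Real.exp 1 := by rw [← Real.exp_add]; norm_num
        nlinarith [Real.exp_pos (1 / 2 : ℝ), Real.exp_one_lt_d9]
  have hγle : γ ≤ 4 * B * |b| :=
    calc γ ≤ 2 * B * |b| * 2 := mul_le_mul_of_nonneg_left he2 (by positivity)
      _ = 4 * B * |b| := by ring
  have hγ1 : γ ≤ 1 := hγle.trans hbB
  ------------------------------------------------------------------ Step 1: centring
  set X₀ : GaugeConfig 4 L G → ℝ := fun U => φ (plaquetteHolonomy U 0 1 2) with hX₀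
  set X₁ : GaugeConfig 4 L G → ℝ := fun U => φ (plaquetteHolonomy U ((0 : Site 4 L).shift 0) 1 2) with hX₁
  have hX₀m : Measurable X₀ := hφm.comp (measurable_plaquetteHolonomy _ _ _)
  have hX₁m : Measurable X₁ := hφm.comp (measurable_plaquetteHolonomy _ _ _)
  have hX₀b : ∀ U, |X₀ U| ≤ Cφ := fun U => hCφ' _
  have hX₁b : ∀ U, |X₁ U| ≤ Cφ := fun U => hCφ' _
  haveI := isProbabilityMeasure_wilsonMeasure (d := 4) (L := L) ρ hρ b
  have hI : ∀ {F : GaugeConfig 4 L G → ℝ} {C : ℝ}, Measurable F → (∀ U, |F U| ≤ C) →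
      Integrable F (wilsonMeasure (d := 4) (L := L) ρ b) := fun hF hb =>
    Integrable.of_bound hF.aestronglyMeasurable _ (Eventually.of_forall fun U => by rw [Real.norm_eq_abs]; exact hb U)
  have hf0 : (fun U : GaugeConfig 4 L G => (ρ (plaquetteHolonomy U 0 1 2)).trace.re) = fun U => X₀ U + m₀ :=
    funext fun U => by simp only [hX₀, hφ]; ring
  have hf1 : (fun U : GaugeConfig 4 L G => (ρ (plaquetteHolonomy U ((0 : Site 4 L).shift 0) 1 2)).trace.re) =
      fun U => X₁ U + m₀ := funext fun U => by simp only [hX₁, hφ]; ring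
  have hf01 : (fun U : GaugeConfig 4 L G => (ρ (plaquetteHolonomy U 0 1 2)).trace.re *
      (ρ (plaquetteHolonomy U ((0 : Site 4 L).shift 0) 1 2)).trace.re) = fun U => (X₀ U + m₀) * (X₁ U + m₀) :=
    funext fun U => by simp only [hX₀, hX₁, hφ]; ring
  rw [hf01, hf0, hf1, cov_add_const (wilsonMeasure (d := 4) (L := L) ρ b) (hI hX₀m hX₀b) (hI hX₁m hX₁b)
    (hI (hX₀m.mul hX₁m) fun U => by rw [abs_mul]; exact mul_le_mul (hX₀b U) (hX₁b U) (abs_nonneg _) hC0) m₀ m₀]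
  ------------------------------------------------------------------ Step 2: doubling and symmetrisation
  have hZpos : 0 < ∫ U, (1 : ℝ) * Real.exp (b * -wilsonAction ρ U) ∂(Measure.pi fun _ : Edge 4 L => haarProbability G) :=
    partition_pos (L := L) ρ hρ b
  have hEm : Measurable fun W : Edge 4 L ⊕ Edge 4 L → G =>
      Real.exp (b * -(wilsonAction ρ (fun e => W (Sum.inl e)) + wilsonAction ρ (fun e => W (Sum.inr e)))) :=
    ((((measurable_wilsonAction ρ hρ).comp measurable_inl_copy).add
      ((measurable_wilsonAction ρ hρ).comp measurable_inr_copy)).neg.const_mul b).exp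
  have hEb : ∀ W : Edge 4 L ⊕ Edge 4 L → G,
      |Real.exp (b * -(wilsonAction ρ (fun e => W (Sum.inl e)) + wilsonAction ρ (fun e => W (Sum.inr e))))| ≤
        Real.exp (|b| * (2 * Smax)) := fun W => by
    rw [Real.abs_exp]
    refine Real.exp_le_exp.2 ((le_abs_self _).trans ?_)
    rw [abs_mul, abs_neg]
    exact mul_le_mul_of_nonneg_left (((abs_add_le _ _).trans (add_le_add (hSmax _) (hSmax _))).trans (le_of_eq (by ring)))
      (abs_nonneg _)
  have hEs : ∀ W : Edge 4 L ⊕ Edge 4 L → G,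
      (fun W : Edge 4 L ⊕ Edge 4 L → G =>
        Real.exp (b * -(wilsonAction ρ (fun e => W (Sum.inl e)) + wilsonAction ρ (fun e => W (Sum.inr e)))))
        (fun i => W (Sum.swap i)) =
      Real.exp (b * -(wilsonAction ρ (fun e => W (Sum.inl e)) + wilsonAction ρ (fun e => W (Sum.inr e)))) :=
    fun W => by simp only [Sum.swap_inl, Sum.swap_inr, add_comm]
  have hdoub := covariance_wilsonMeasure_eq_doubled (L := L) ρ hρ hX₀m hX₁m hX₀b hX₁b b
  have hsym := doubled_symmetrise (L := L) hX₀m hX₁m hX₀b hX₁b hEm hEb hEs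
  have hkey := hdoub.trans hsym
  beta_reduce at hkey
  simp only [hX₀, hX₁] at hkey
  ------------------------------------------------------------------ Step 3: the Mayer expansion under the integral
  have hd0 : ∀ h h' : G, |φ h - φ h'| ≤ 2 * Cφ := fun h h' => (abs_sub _ _).trans (by linarith [hCφ' h, hCφ' h'])
  have hΔΔm : Measurable fun W : Edge 4 L ⊕ Edge 4 L → G => (φ (plaquetteHolonomy (fun a => W (Sum.inl a)) 0 1 2) - φ (plaquetteHolonomy (fun a => W (Sum.inr a)) 0 1 2)) *
          (φ (plaquetteHolonomy (fun a => W (Sum.inl a)) ((0 : Site 4 L).shift 0) 1 2) -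
            φ (plaquetteHolonomy (fun a => W (Sum.inr a)) ((0 : Site 4 L).shift 0) 1 2)) :=
    (((hφm.comp ((measurable_plaquetteHolonomy _ _ _).comp measurable_inl_copy)).sub
      (hφm.comp ((measurable_plaquetteHolonomy _ _ _).comp measurable_inr_copy))).mul
      ((hφm.comp ((measurable_plaquetteHolonomy _ _ _).comp measurable_inl_copy)).sub
        (hφm.comp ((measurable_plaquetteHolonomy _ _ _).comp measurable_inr_copy))))
  have hΔΔb : ∀ W : Edge 4 L ⊕ Edge 4 L → G, |(φ (plaquetteHolonomy (fun a => W (Sum.inl a)) 0 1 2) - φ (plaquetteHolonomy (fun a => W (Sum.inr a)) 0 1 2)) *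
          (φ (plaquetteHolonomy (fun a => W (Sum.inl a)) ((0 : Site 4 L).shift 0) 1 2) -
            φ (plaquetteHolonomy (fun a => W (Sum.inr a)) ((0 : Site 4 L).shift 0) 1 2))| ≤ σ2 := fun W => by
    rw [abs_mul, hσ2]; exact mul_le_mul (hd0 _ _) (hd0 _ _) (abs_nonneg _) (by positivity)
  have hσ0 : 0 ≤ σ2 := by positivity
  have hmayer : ∫ W, (φ (plaquetteHolonomy (fun a => W (Sum.inl a)) 0 1 2) - φ (plaquetteHolonomy (fun a => W (Sum.inr a)) 0 1 2)) *
          (φ (plaquetteHolonomy (fun a => W (Sum.inl a)) ((0 : Site 4 L).shift 0) 1 2) -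
            φ (plaquetteHolonomy (fun a => W (Sum.inr a)) ((0 : Site 4 L).shift 0) 1 2)) * Real.exp (b * -(wilsonAction ρ (fun e => W (Sum.inl e)) + wilsonAction ρ (fun e => W (Sum.inr e)))) ∂(Measure.pi fun _ : Edge 4 L ⊕ Edge 4 L => haarProbability G) =
      ∑ Q ∈ (Finset.univ : Finset (Plaquette 4 L)).powerset,
        ∫ W, (φ (plaquetteHolonomy (fun a => W (Sum.inl a)) 0 1 2) - φ (plaquetteHolonomy (fun a => W (Sum.inr a)) 0 1 2)) *
          (φ (plaquetteHolonomy (fun a => W (Sum.inl a)) ((0 : Site 4 L).shift 0) 1 2) -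
            φ (plaquetteHolonomy (fun a => W (Sum.inr a)) ((0 : Site 4 L).shift 0) 1 2)) * ∏ q ∈ Q, (Real.exp (-(b * dTerm ρ q W)) - 1) ∂(Measure.pi fun _ : Edge 4 L ⊕ Edge 4 L => haarProbability G) := by
    have hpt : ∀ W : Edge 4 L ⊕ Edge 4 L → G, (φ (plaquetteHolonomy (fun a => W (Sum.inl a)) 0 1 2) - φ (plaquetteHolonomy (fun a => W (Sum.inr a)) 0 1 2)) *
          (φ (plaquetteHolonomy (fun a => W (Sum.inl a)) ((0 : Site 4 L).shift 0) 1 2) -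
            φ (plaquetteHolonomy (fun a => W (Sum.inr a)) ((0 : Site 4 L).shift 0) 1 2)) * Real.exp (b * -(wilsonAction ρ (fun e => W (Sum.inl e)) + wilsonAction ρ (fun e => W (Sum.inr e)))) =
        ∑ Q ∈ (Finset.univ : Finset (Plaquette 4 L)).powerset, (φ (plaquetteHolonomy (fun a => W (Sum.inl a)) 0 1 2) - φ (plaquetteHolonomy (fun a => W (Sum.inr a)) 0 1 2)) *
          (φ (plaquetteHolonomy (fun a => W (Sum.inl a)) ((0 : Site 4 L).shift 0) 1 2) -
            φ (plaquetteHolonomy (fun a => W (Sum.inr a)) ((0 : Site 4 L).shift 0) 1 2)) * ∏ q ∈ Q, (Real.exp (-(b * dTerm ρ q W)) - 1) :=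
      fun W => by rw [mayer_expansion ρ b W, Finset.mul_sum]
    simp_rw [hpt]
    refine integral_finsetSum _ fun Q _ => ?_
    exact Integrable.of_bound (hΔΔm.mul (measurable_prod_mayerWeight ρ hρ b Q)).aestronglyMeasurable
      (σ2 * γ ^ Q.card) (Eventually.of_forall fun W => by
        rw [Real.norm_eq_abs, abs_mul]
        exact mul_le_mul (hΔΔb W) (abs_prod_mayerWeight_le ρ hB b Q W) (abs_nonneg _) hσ0)
  ------------------------------------------------------------------ Step 4: reduction to the lateral term
  have hred := mayer_sum_reduction (L := L) ρ hρ hL hφc hCφ' hB b hγ1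
  have hlat' := hlat b hbb₁
  rw [← hJ] at hlat'
  clear_value J
  ------------------------------------------------------------------ Step 5: the partition function
  have hZ1 : |(∫ U, (1 : ℝ) * Real.exp (b * -wilsonAction ρ U) ∂(Measure.pi fun _ : Edge 4 L => haarProbability G)) - 1| ≤ 2 * |b| * Smax := by
    have h := abs_partition_sub_one_le (L := L) ρ hρ hSmax b
    have he : Real.exp (|b| * Smax) ≤ 2 :=
      calc Real.exp (|b| * Smax) ≤ Real.exp (1 / 2) := Real.exp_le_exp.2 (by nlinarith only [abs_nonneg b, hbS, hSmax0])
        _ ≤ 2 := by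
          have h2 : Real.exp (1 / 2) * Real.exp (1 / 2) = Real.exp 1 := by rw [← Real.exp_add]; norm_num
          nlinarith only [h2, Real.exp_pos (1 / 2 : ℝ), Real.exp_one_lt_d9, Real.add_one_le_exp (1/2 : ℝ)]
    calc |(∫ U, (1 : ℝ) * Real.exp (b * -wilsonAction ρ U) ∂(Measure.pi fun _ : Edge 4 L => haarProbability G)) - 1| ≤ |b| * Smax * Real.exp (|b| * Smax) := h
      _ ≤ |b| * Smax * 2 := mul_le_mul_of_nonneg_left he (by positivity)
      _ = 2 * |b| * Smax := by ring
  set Z : ℝ := (∫ U, (1 : ℝ) * Real.exp (b * -wilsonAction ρ U) ∂(Measure.pi fun _ : Edge 4 L => haarProbability G)) with hZ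
  clear_value Z
  have hZhalf : 1 / 2 ≤ Z := by
    have : Z - 1 ≥ -(2 * |b| * Smax) := (abs_le.1 hZ1).1
    linarith only [this, hbS]
  have hZ2 : Z ≤ 2 := by
    have : Z - 1 ≤ 2 * |b| * Smax := (abs_le.1 hZ1).2
    linarith only [this, hbS]
  have hZsq : |1 - Z ^ 2| ≤ 6 * |b| * Smax := by
    rw [show (1 : ℝ) - Z ^ 2 = (1 - Z) * (1 + Z) by ring, abs_mul, abs_sub_comm]
    calc |Z - 1| * |1 + Z| ≤ (2 * |b| * Smax) * 3 := by
          refine mul_le_mul hZ1 ?_ (abs_nonneg _) (by positivity)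
          rw [abs_of_nonneg (by linarith only [hZhalf])]; linarith only [hZ2]
      _ = 6 * |b| * Smax := by ring
  ------------------------------------------------------------------ Step 6: assembly
  set Cv : ℝ := ((∫ U, X₀ U * X₁ U ∂(wilsonMeasure (d := 4) (L := L) ρ b)) -
      (∫ U, X₀ U ∂(wilsonMeasure (d := 4) (L := L) ρ b)) * ∫ U, X₁ U ∂(wilsonMeasure (d := 4) (L := L) ρ b)) with hCv
  set Ssum : ℝ := ∑ Q ∈ (Finset.univ : Finset (Plaquette 4 L)).powerset,
    ∫ W, (φ (plaquetteHolonomy (fun a => W (Sum.inl a)) 0 1 2) - φ (plaquetteHolonomy (fun a => W (Sum.inr a)) 0 1 2)) *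
          (φ (plaquetteHolonomy (fun a => W (Sum.inl a)) ((0 : Site 4 L).shift 0) 1 2) -
            φ (plaquetteHolonomy (fun a => W (Sum.inr a)) ((0 : Site 4 L).shift 0) 1 2)) * ∏ q ∈ Q, (Real.exp (-(b * dTerm ρ q W)) - 1) ∂(Measure.pi fun _ : Edge 4 L ⊕ Edge 4 L => haarProbability G) with hSsum
  set TL : ℝ := ∫ W, (φ (plaquetteHolonomy (fun a => W (Sum.inl a)) 0 1 2) - φ (plaquetteHolonomy (fun a => W (Sum.inr a)) 0 1 2)) *
          (φ (plaquetteHolonomy (fun a => W (Sum.inl a)) ((0 : Site 4 L).shift 0) 1 2) -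
            φ (plaquetteHolonomy (fun a => W (Sum.inr a)) ((0 : Site 4 L).shift 0) 1 2)) * ∏ k : Fin 4, (Real.exp (-(b * dTerm ρ ((![((0 : Site 4 L), ⟨((0 : Fin 4), (1 : Fin 4)), by decide⟩), ((0 : Site 4 L).shift 2, ⟨((0 : Fin 4), (1 : Fin 4)), by decide⟩),
        ((0 : Site 4 L), ⟨((0 : Fin 4), (2 : Fin 4)), by decide⟩), ((0 : Site 4 L).shift 1, ⟨((0 : Fin 4), (2 : Fin 4)), by decide⟩)] :
        Fin 4 → Plaquette 4 L) k) W)) - 1) ∂(Measure.pi fun _ : Edge 4 L ⊕ Edge 4 L => haarProbability G) with hTL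
  have hS : Z ^ 2 * Cv = (1 / 2) * Ssum := by rw [hkey, hmayer]
  clear_value Cv Ssum TL
  have hnum : |Z ^ 2 * Cv - J * b ^ 4| ≤ (K₁ / 2 + nP * σ2 * (4 * B) ^ 5 / 2) * |b| ^ 5 := by
    rw [hS]
    have h1 : |Ssum - 2 * J * b ^ 4| ≤ K₁ * |b| ^ 5 + nP * σ2 * γ ^ 5 := by
      calc |Ssum - 2 * J * b ^ 4| = |(Ssum - TL) + (TL - 2 * J * b ^ 4)| := by ring_nf
        _ ≤ |Ssum - TL| + |TL - 2 * J * b ^ 4| := abs_add_le _ _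
        _ ≤ nP * σ2 * γ ^ 5 + K₁ * |b| ^ 5 := add_le_add hred hlat'
        _ = _ := by ring
    have hγ5 : γ ^ 5 ≤ (4 * B) ^ 5 * |b| ^ 5 := by
      rw [← mul_pow]; exact pow_le_pow_left₀ hγ0 (by linarith only [hγle]) 5
    rw [show (1 / 2 : ℝ) * Ssum - J * b ^ 4 = (1 / 2) * (Ssum - 2 * J * b ^ 4) by ring, abs_mul,
      abs_of_pos (by norm_num : (0 : ℝ) < 1 / 2)]
    have hnP0 : 0 ≤ nP := by positivity
    have h2 := mul_le_mul_of_nonneg_left hγ5 (mul_nonneg hnP0 hσ0)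
    linarith only [h1, h2]
  have hZ2pos : 0 < Z ^ 2 := by positivity
  have hZ2lb : 1 / 4 ≤ Z ^ 2 :=
    calc (1 : ℝ) / 4 = (1 / 2) * (1 / 2) := by norm_num
      _ ≤ Z * Z := mul_le_mul hZhalf hZhalf (by norm_num) (by linarith only [hZhalf])
      _ = Z ^ 2 := (sq Z).symm
  change |Cv - J * b ^ 4| ≤ (4 * (K₁ / 2 + nP * σ2 * (4 * B) ^ 5 / 2) + 24 * |J| * Smax) * |b| ^ 5
  have hdecomp : Cv - J * b ^ 4 = ((Z ^ 2 * Cv - J * b ^ 4) + J * b ^ 4 * (1 - Z ^ 2)) / Z ^ 2 := by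
    field_simp
    ring
  rw [hdecomp, abs_div, abs_of_pos hZ2pos, div_le_iff₀ hZ2pos]
  have hb4 : |b ^ 4| = |b| ^ 4 := abs_pow b 4
  calc |Z ^ 2 * Cv - J * b ^ 4 + J * b ^ 4 * (1 - Z ^ 2)|
      ≤ |Z ^ 2 * Cv - J * b ^ 4| + |J| * |b| ^ 4 * (6 * |b| * Smax) := by
        refine (abs_add_le _ _).trans (add_le_add le_rfl ?_)
        rw [abs_mul, abs_mul, hb4]
        exact mul_le_mul_of_nonneg_left hZsq (by positivity)
    _ ≤ (K₁ / 2 + nP * σ2 * (4 * B) ^ 5 / 2) * |b| ^ 5 + 6 * |J| * Smax * |b| ^ 5 := by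
        have : |J| * |b| ^ 4 * (6 * |b| * Smax) = 6 * |J| * Smax * |b| ^ 5 := by ring
        rw [this]; exact add_le_add hnum le_rfl
    _ ≤ (4 * (K₁ / 2 + nP * σ2 * (4 * B) ^ 5 / 2) + 24 * |J| * Smax) * |b| ^ 5 * Z ^ 2 := by
        have hK2 : 0 ≤ (K₁ / 2 + nP * σ2 * (4 * B) ^ 5 / 2) * |b| ^ 5 := le_trans (abs_nonneg _) hnum
        have hJ5 : 0 ≤ 6 * |J| * Smax * |b| ^ 5 := by positivity
        nlinarith only [mul_nonneg (sub_nonneg.2 hZ2lb) hK2, mul_nonneg (sub_nonneg.2 hZ2lb) hJ5, hK2, hJ5]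

end Summit.QuantumFields.YangMills.Cruxes.IR.SCFloor

end
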